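import Summits.KontsevichZagierPeriods.KontsevichZagierPeriods.Theorems.HermiteRigidityReductionRigidityTorusGen

/-!
# KontsevichZagierPeriods / HermiteRigidity — crux `ReductionRigidity` (stmt-KontsevichZagierPeriods-3407), line `Sketch` (Padé box island, every weight): EULER DESCENT

Route `KontsevichZagierPeriods/HermiteRigidity`, crux stmt-KontsevichZagierPeriods-3407, crux-chain line `Sketch`
(skeleton `Cruxes/ReductionRigidity/Lines/Sketch.lean`, v7). The stub `stub_eulerGen` (integer level `N ≥ 2`)
and its rational-level form `eulerGen` (`ν > 1` or `ν < 0`): the POLE-ORDER DESCENT on the closed unit cube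
`□^{j+1}` in every dimension. With `h = q·x^a/(N − u)^{m+1}` (`u = x₀⋯x_j`) and the last coordinate `x_L`,

  `∂_L(x_L·h) = (a_L + 1)·h + (m+1)·h·u/(N − u) = (a_L − m)·h + N(m+1)·q·x^a/(N − u)^{m+2}`,

so one cubical Stokes move along `x_L` (the torus leg `torusGen_leg` of the companion file, taken at pole
order `m + 1`) plus one integrand-additivity move give the registered congruence

  `[□^{j+1}, q x^a/(N−u)^{m+2}] ≡ [□ʲ, q/(N(m+1))·x^{a∘castSucc}/(N−u)^{m+1}] + [□^{j+1}, q(m − a_L)/(N(m+1))·x^a/(N−u)^{m+1}]`.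

References: M. Kontsevich, D. Zagier, *Periods* (2001), §1.2 rules (1), (3) [cite: KontsevichZagier2001, §1.2];
J. Ayoub, EMS Newsl. 91 (2014), Def. 10 [cite: Ayoub2014, Def. 10].
-/

noncomputable section

open MeasureTheory Set MvPolynomial

namespace Summit.KontsevichZagierPeriods.HermiteRigidity.ReductionRigidity

open Literature.NumberTheory.Transcendental
open Literature.NumberTheory.Transcendental.KZ

/-- **Euler descent along the last coordinate in every dimension, at a RATIONAL level `ν > 1` or
`ν < 0`:** `[□^{j+1}, q x^a/(ν−u)^{m+2}] ≡ [□ʲ, q/(ν(m+1))·x^{a∘castSucc}/(ν−u)^{m+1}] +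
[□^{j+1}, q(m − a_L)/(ν(m+1))·x^a/(ν−u)^{m+1}]` — one cubical Stokes move along `x_L` (the torus leg at pole
order `m + 1`) plus one integrand-additivity move. [cite: KontsevichZagier2001, §1.2 rules (1), (3)]
[cite: Ayoub2014, Def. 10] -/
theorem eulerGen : ∀ (j : ℕ) (ν : ℚ), (1 < ν ∨ ν < 0) → ∀ (q : ℚ) (a : Fin (j + 1) → ℕ) (m : ℕ)
    (r : IntegralRep (j + 1)) (r₁ : IntegralRep j) (r' : IntegralRep (j + 1)),
    r.domain = cube (j + 1) →
    EqOn r.integrand (fun p => (q : ℝ) * (∏ l, p l ^ a l) / ((ν : ℝ) - ∏ l, p l) ^ (m + 2)) (cube (j + 1)) →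
    r₁.domain = cube j →
    EqOn r₁.integrand (fun p => ((q / (ν * ((m : ℚ) + 1)) : ℚ) : ℝ) * (∏ l, p l ^ a (Fin.castSucc l)) /
      ((ν : ℝ) - ∏ l, p l) ^ (m + 1)) (cube j) →
    r'.domain = cube (j + 1) →
    EqOn r'.integrand (fun p => ((q * ((m : ℚ) - a (Fin.last j)) / (ν * ((m : ℚ) + 1)) : ℚ) : ℝ) *
      (∏ l, p l ^ a l) / ((ν : ℝ) - ∏ l, p l) ^ (m + 1)) (cube (j + 1)) →
    KZ.of r - (KZ.of r₁ + KZ.of r') ∈ KZ.relations := by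
  intro j ν hν q a m r r₁ r' hr hri hr₁ hr₁i hr' hr'i
  have hν0 : (ν : ℝ) ≠ 0 := by
    rcases hν with h | h
    · have : (1 : ℝ) < ν := by exact_mod_cast h
      linarith
    · have : (ν : ℝ) < 0 := by exact_mod_cast h
      linarith
  have hm1 : ((m : ℝ) + 1) ≠ 0 := by positivity
  -- the torus leg along the last coordinate at pole order `m + 1`
  obtain ⟨T, hT, hleg⟩ := torusGen_leg hν (q / (ν * ((m : ℚ) + 1))) a (m + 1) (Fin.last j) r₁ hr₁
    (fun p hp => by rw [hr₁i hp]; simp only [Fin.succAbove_last])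
  -- the pointwise identity `q·x^a/(ν−u)^{m+2} = ∂_L(x_L h) + (q(m − a_L)/(ν(m+1)))·x^a/(ν−u)^{m+1}`
  have hsplit : KZ.of r - KZ.of (T.pd (Fin.last j)).rep - KZ.of r' ∈ KZ.relations := by
    refine integrandAddRel_subset_relations ⟨j + 1, r, (T.pd (Fin.last j)).rep, r',
      by rw [RFun.rep_domain, hr], hr'.trans hr.symm, fun p hp => ?_, rfl⟩
    rw [hr] at hp
    rw [Pi.add_apply, hri hp, RFun.rep_integrand, hT p hp, hr'i hp]
    have hden : (ν : ℝ) - ∏ l, p l ≠ 0 := torusGen_sub_prod_ne hν hp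
    push_cast
    field_simp
    ring
  have : KZ.of r - (KZ.of r₁ + KZ.of r') =
      (KZ.of r - KZ.of (T.pd (Fin.last j)).rep - KZ.of r') + (KZ.of (T.pd (Fin.last j)).rep - KZ.of r₁) := by
    abel
  rw [this]
  exact KZ.relations.add_mem hsplit hleg

/-- **STUB `eulerGen` (PROVED; the registered integer-level form `N ≥ 2`): Euler descent along the last
coordinate in every dimension.** [cite: KontsevichZagier2001, §1.2 rules (1), (3)] [cite: Ayoub2014, Def. 10] -/
theorem stub_eulerGen : ∀ (j N : ℕ), 2 ≤ N → ∀ (q : ℚ) (a : Fin (j + 1) → ℕ) (m : ℕ)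
    (r : IntegralRep (j + 1)) (r₁ : IntegralRep j) (r' : IntegralRep (j + 1)),
    r.domain = cube (j + 1) →
    EqOn r.integrand (fun p => (q : ℝ) * (∏ l, p l ^ a l) / ((N : ℝ) - ∏ l, p l) ^ (m + 2)) (cube (j + 1)) →
    r₁.domain = cube j →
    EqOn r₁.integrand (fun p => ((q / ((N : ℚ) * ((m : ℚ) + 1)) : ℚ) : ℝ) * (∏ l, p l ^ a (Fin.castSucc l)) /
      ((N : ℝ) - ∏ l, p l) ^ (m + 1)) (cube j) →
    r'.domain = cube (j + 1) →
    EqOn r'.integrand (fun p => ((q * ((m : ℚ) - a (Fin.last j)) / ((N : ℚ) * ((m : ℚ) + 1)) : ℚ) : ℝ) *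
      (∏ l, p l ^ a l) / ((N : ℝ) - ∏ l, p l) ^ (m + 1)) (cube (j + 1)) →
    KZ.of r - (KZ.of r₁ + KZ.of r') ∈ KZ.relations := by
  intro j N hN q a m r r₁ r' hr hri hr₁ hr₁i hr' hr'i
  have hν : (1 : ℚ) < N ∨ (N : ℚ) < 0 := Or.inl (by exact_mod_cast hN)
  exact eulerGen j N hν q a m r r₁ r' hr (fun p hp => by rw [hri hp]; push_cast; rfl) hr₁
    (fun p hp => by rw [hr₁i hp]; push_cast; rfl) hr' (fun p hp => by rw [hr'i hp]; push_cast; rfl)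

end Summit.KontsevichZagierPeriods.HermiteRigidity.ReductionRigidity

end
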